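/-
Copyright: pub-balaban β-flow team, β-FLOW PROVER 4 (unit `b2b-balaban-beta-bflow-p4`, gen 7; coordinator ruling «YM
ACCELERATION» 2026-08-21 item (2), «work behind the as-printed interface»).  Lattice calculus only ([folklore]): the
pyramid (tensor-product tent) test functions on `ℤ^d` and the asymptotics of their lattice Dirichlet increment forms — the
device by which PART 17 reads the coefficient of ½‖∂B‖² in (3.65) off the vacuum-polarization kernel (3.67).  Nothing of
Bałaban's model is mentioned here; NOT BetaPertH, NOT continuum, NOT Clay.
-/
import Mathlib
import Literature.MathematicalPhysics.QuantumFieldTheory.Balaban1983to89.Beta.PolarizationSign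

/-!
# `Beta.EriceTentCalculus` — PART 17a of the `EriceLoopExpansionD4` series: pyramid test functions on `ℤ^d`

Pure lattice calculus, [folklore] throughout; no object of [BalabanJaffe1986] ∕ [Balaban1987RG1] occurs.  Used by PART 17
(`Beta.EriceZetaSecondMoment`): the quadratic form `½⟨B, Π ∗ B⟩` of a translation-invariant kernel on a ONE-COMPONENT
slowly varying test field is governed by the Dirichlet increment form `D(z) = Σ_x (T(x) − T(x − z))²` of the profile `T`;
for the pyramid `T_R(x) = ∏_i max(0, R − |x_i|)` this file and its sibling `Beta.EriceTentPyramid` prove `D_R(e_μ) =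
n_R^{d−1}·d_R(1)` (the same for every axis), `0 ≤ D_R(z)/D_R(e_1) ≤ 2·size(z)³` for `R ≥ 1`, and `D_R(z)/D_R(e_1) → Σ_i z_i²`
as `R → ∞` — so that a summable third moment of the kernel dominates, and the limit is the trace of the second-moment
matrix.  THIS FILE: the one-dimensional tent (the sandwich `2(R−s+1)s² ≤ d_R(s) ≤ (2R+2|s|+1)s²` and `d_R(s)/d_R(1) → s²`).

DESIGN.  Def-free (the lineage's proof lane): the one-dimensional tent enters through a function `h : ℤ → ℝ` with the
hypothesis `∀ t, h t = max 0 (R − |t|)`, the pyramid through `x ↦ ∏ i, h (x i)`; sums over `ℤ` ∕ `ℤ^d` are `tsum`s of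
finitely supported functions (shift invariance by `Equiv.tsum_eq`, evaluation by `tsum_eq_sum`).
* §1 finitely supported functions on an additive group: shift invariance, the polarization identity
  `Σ (f(x) − f(x−z))² = 2Σ f² − 2Σ f(x)f(x−z)`, symmetry `z ↦ −z`.
* §2 the tent on `ℤ`: support, Lipschitz, `Σ h² ≥ R³/4`, the sandwich `2(R−s+1)s² ≤ d_R(s) ≤ (2R+2|s|+1)s²`
  (`1 ≤ s ≤ R` for the lower member), hence `d_R(s)/d_R(1) → s²`.
* (§3 tensor products over `Fin d` and §4 the pyramid — domination, limit, growth, amplitude — are the sibling PART 17a′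
  `Beta.EriceTentPyramid`, split off for the 400-line rule.)
-/

namespace Summit.QuantumFields.BalabanUV.Beta.EriceTentCalculus

open Literature.MathematicalPhysics.QuantumFieldTheory.Balaban1983to89
open Literature.MathematicalPhysics.QuantumFieldTheory.Balaban1983to89.Beta
open Literature.MathematicalPhysics.QuantumFieldTheory.Balaban1983to89.Beta.PolarizationSign (size one_le_size size_pos
  abs_apply_le_size)
open Literature.MathematicalPhysics.QuantumFieldTheory.Balaban1983to89.B6BondElimination (unitVec unitVec_apply)
open scoped BigOperators
open Filter Topology

/-! ## §1. Finitely supported functions on an additive group: shifts and polarization -/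

section Group

variable {G : Type*} [AddCommGroup G]

/-- Shift invariance of the lattice sum: `Σ_x f(x − z) = Σ_x f(x)` (re-indexing by the bijection `x ↦ x − z`; no
summability needed). [folklore] -/
theorem tsum_sub_shift (f : G → ℝ) (z : G) : ∑' x, f (x - z) = ∑' x, f x :=
  (Equiv.subRight z).tsum_eq f

/-- Shift invariance, additive form: `Σ_x f(x + z) = Σ_x f(x)`. [folklore] -/
theorem tsum_add_shift (f : G → ℝ) (z : G) : ∑' x, f (x + z) = ∑' x, f x :=
  (Equiv.addRight z).tsum_eq f

/-- **Polarization of the Dirichlet increment form**: for `f` vanishing off a finite set,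
`Σ_x (f(x) − f(x − z))² = 2Σ_x f(x)² − 2Σ_x f(x) f(x − z)`. [folklore] -/
theorem tsum_sq_sub_shift_eq {f : G → ℝ} {s : Finset G} (hf : ∀ x ∉ s, f x = 0) (z : G) :
    ∑' x, (f x - f (x - z)) ^ 2 = 2 * ∑' x, f x ^ 2 - 2 * ∑' x, f x * f (x - z) := by
  classical
  have h1 : Summable fun x => f x ^ 2 := summable_of_ne_finset_zero (s := s) fun x hx => by simp [hf x hx]
  have h2 : Summable fun x => f (x - z) ^ 2 :=
    summable_of_ne_finset_zero (s := s.image (· + z)) fun x hx => by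
      have : x - z ∉ s := fun h => hx (Finset.mem_image.mpr ⟨x - z, h, by simp⟩)
      simp [hf _ this]
  have h3 : Summable fun x => f x * f (x - z) := summable_of_ne_finset_zero (s := s) fun x hx => by simp [hf x hx]
  have hexp : ∀ x, (f x - f (x - z)) ^ 2 = (f x ^ 2 + f (x - z) ^ 2) - 2 * (f x * f (x - z)) := fun x => by ring
  simp_rw [hexp]
  rw [(h1.add h2).tsum_sub (h3.mul_left 2), h1.tsum_add h2, tsum_mul_left, tsum_sub_shift (fun x => f x ^ 2) z]
  ring

/-- The autocorrelation in terms of the increment form: `Σ_x f(x)f(x−z) = Σ_x f(x)² − ½Σ_x (f(x) − f(x−z))²`. [folklore] -/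
theorem tsum_mul_shift_eq {f : G → ℝ} {s : Finset G} (hf : ∀ x ∉ s, f x = 0) (z : G) :
    ∑' x, f x * f (x - z) = ∑' x, f x ^ 2 - (1 / 2) * ∑' x, (f x - f (x - z)) ^ 2 := by
  rw [tsum_sq_sub_shift_eq hf z]; ring

/-- Symmetry of the increment form: `Σ_x (f(x) − f(x − z))² = Σ_x (f(x) − f(x + z))²`. [folklore] -/
theorem tsum_sq_sub_shift_symm (f : G → ℝ) (z : G) :
    ∑' x, (f x - f (x - z)) ^ 2 = ∑' x, (f x - f (x + z)) ^ 2 := by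
  rw [← tsum_add_shift (fun x => (f x - f (x - z)) ^ 2) z]
  refine tsum_congr fun x => ?_
  rw [add_sub_cancel_right]; ring

/-- The increment form is nonnegative termwise, hence `Σ_x f(x)f(x−z) ≤ Σ_x f(x)²`. [folklore] -/
theorem tsum_mul_shift_le {f : G → ℝ} {s : Finset G} (hf : ∀ x ∉ s, f x = 0) (z : G) :
    ∑' x, f x * f (x - z) ≤ ∑' x, f x ^ 2 := by
  rw [tsum_mul_shift_eq hf z]
  have : 0 ≤ ∑' x, (f x - f (x - z)) ^ 2 := tsum_nonneg fun x => sq_nonneg _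
  linarith

/-- For a nonnegative `f` the autocorrelation is nonnegative: `0 ≤ Σ_x f(x)f(x−z)`. [folklore] -/
theorem tsum_mul_shift_nonneg {f : G → ℝ} (hf0 : ∀ x, 0 ≤ f x) (z : G) : 0 ≤ ∑' x, f x * f (x - z) :=
  tsum_nonneg fun x => mul_nonneg (hf0 x) (hf0 _)

end Group

/-! ## §2. The one-dimensional tent `h_R(t) = max(0, R − |t|)` on `ℤ` -/

section Tent

variable {R : ℕ} {h : ℤ → ℝ}

/-- `0 ≤ h_R`. [folklore] -/
theorem tent_nonneg (hh : ∀ t, h t = max 0 ((R : ℝ) - |(t : ℝ)|)) (t : ℤ) : 0 ≤ h t := by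
  rw [hh]; exact le_max_left _ _

/-- `h_R ≤ R`. [folklore] -/
theorem tent_le (hh : ∀ t, h t = max 0 ((R : ℝ) - |(t : ℝ)|)) (t : ℤ) : h t ≤ R := by
  rw [hh]; exact max_le (Nat.cast_nonneg R) (by linarith [abs_nonneg (t : ℝ)])

/-- `h_R(0) = R`. [folklore] -/
theorem tent_zero (hh : ∀ t, h t = max 0 ((R : ℝ) - |(t : ℝ)|)) : h 0 = R := by
  rw [hh]; simp

/-- `h_R(t) = 0` for `R ≤ |t|`. [folklore] -/
theorem tent_eq_zero (hh : ∀ t, h t = max 0 ((R : ℝ) - |(t : ℝ)|)) {t : ℤ} (ht : (R : ℤ) ≤ |t|) : h t = 0 := by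
  rw [hh]
  have : (R : ℝ) ≤ |(t : ℝ)| := by rw [← Int.cast_abs]; exact_mod_cast ht
  exact max_eq_left (by linarith)

/-- The support of `h_R` lies in `[−R, R]`. [folklore] -/
theorem tent_support (hh : ∀ t, h t = max 0 ((R : ℝ) - |(t : ℝ)|)) (t : ℤ) (ht : t ∉ Finset.Icc (-(R : ℤ)) R) :
    h t = 0 := by
  refine tent_eq_zero hh ?_
  rw [Finset.mem_Icc, not_and_or, not_le, not_le] at ht
  rcases ht with ht | ht
  · rw [abs_of_neg (by omega)]; omega
  · rw [abs_of_pos (by omega)]; omega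

/-- The tent is 1-Lipschitz: `|h_R(t) − h_R(u)| ≤ |t − u|`. [folklore] -/
theorem tent_lipschitz (hh : ∀ t, h t = max 0 ((R : ℝ) - |(t : ℝ)|)) (t u : ℤ) :
    |h t - h u| ≤ |((t : ℝ) - u)| := by
  rw [hh, hh, max_comm (0 : ℝ), max_comm (0 : ℝ)]
  calc |max ((R : ℝ) - |(t : ℝ)|) 0 - max ((R : ℝ) - |(u : ℝ)|) 0|
      ≤ |((R : ℝ) - |(t : ℝ)|) - ((R : ℝ) - |(u : ℝ)|)| := abs_max_sub_max_le_abs _ _ _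
    _ = |(|(u : ℝ)| - |(t : ℝ)|)| := by ring_nf
    _ ≤ |(u : ℝ) - t| := abs_abs_sub_abs_le_abs_sub _ _
    _ = |((t : ℝ) - u)| := abs_sub_comm _ _

/-- On `0 ≤ t ≤ R`: `h_R(t) = R − t`. [folklore] -/
theorem tent_eq_of_nonneg (hh : ∀ t, h t = max 0 ((R : ℝ) - |(t : ℝ)|)) {t : ℤ} (h0 : 0 ≤ t) (hR : t ≤ R) :
    h t = R - t := by
  rw [hh, abs_of_nonneg (by exact_mod_cast h0)]
  exact max_eq_right (by rw [sub_nonneg]; exact_mod_cast hR)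

/-- On `−R ≤ t ≤ 0`: `h_R(t) = R + t`. [folklore] -/
theorem tent_eq_of_nonpos (hh : ∀ t, h t = max 0 ((R : ℝ) - |(t : ℝ)|)) {t : ℤ} (h0 : t ≤ 0) (hR : -(R : ℤ) ≤ t) :
    h t = R + t := by
  rw [hh, abs_of_nonpos (by exact_mod_cast h0), sub_neg_eq_add]
  have hR' : (((-(R : ℤ)) : ℤ) : ℝ) ≤ t := by exact_mod_cast hR
  push_cast at hR'
  exact max_eq_right (by linarith)

/-- `Σ_t h_R(t)²` is the finite sum over `[−R, R]`. [folklore] -/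
theorem tsum_tent_sq_eq_sum (hh : ∀ t, h t = max 0 ((R : ℝ) - |(t : ℝ)|)) :
    ∑' t, h t ^ 2 = ∑ t ∈ Finset.Icc (-(R : ℤ)) R, h t ^ 2 :=
  tsum_eq_sum fun t ht => by simp [tent_support hh t ht]

/-- **The mass of the tent**: `Σ_t h_R(t)² ≥ R³/4` (on `|t| ≤ R/2` the tent is `≥ R/2`, and there are `≥ R` such `t`).
[folklore] -/
theorem tent_sq_sum_ge (hh : ∀ t, h t = max 0 ((R : ℝ) - |(t : ℝ)|)) : (R : ℝ) ^ 3 / 4 ≤ ∑' t, h t ^ 2 := by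
  rw [tsum_tent_sq_eq_sum hh]
  set M : ℕ := R / 2 with hM
  have hM2 : 2 * M ≤ R := by omega
  have hMR : R ≤ 2 * M + 1 := by omega
  have hsub : Finset.Icc (-(M : ℤ)) M ⊆ Finset.Icc (-(R : ℤ)) R := by
    intro t ht; rw [Finset.mem_Icc] at ht ⊢; omega
  have hcard : (Finset.Icc (-(M : ℤ)) M).card = 2 * M + 1 := by
    rw [Int.card_Icc]; try omega
  have hval : ∀ t ∈ Finset.Icc (-(M : ℤ)) M, ((R : ℝ) / 2) ^ 2 ≤ h t ^ 2 := by
    intro t ht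
    rw [Finset.mem_Icc] at ht
    have habs : |(t : ℝ)| ≤ M := by rw [← Int.cast_abs]; exact_mod_cast abs_le.mpr ⟨ht.1, ht.2⟩
    have hMr : (M : ℝ) ≤ (R : ℝ) / 2 := by
      have : ((2 * M : ℕ) : ℝ) ≤ R := by exact_mod_cast hM2
      push_cast at this; linarith
    have hge : (R : ℝ) / 2 ≤ h t := by rw [hh]; exact le_max_of_le_right (by linarith)
    exact pow_le_pow_left₀ (by positivity) hge 2
  calc (R : ℝ) ^ 3 / 4 = (R : ℝ) * ((R : ℝ) / 2) ^ 2 := by ring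
    _ ≤ ((2 * M + 1 : ℕ) : ℝ) * ((R : ℝ) / 2) ^ 2 := by gcongr
    _ = (Finset.Icc (-(M : ℤ)) M).card • ((R : ℝ) / 2) ^ 2 := by rw [hcard, nsmul_eq_mul]
    _ ≤ ∑ t ∈ Finset.Icc (-(M : ℤ)) M, h t ^ 2 := Finset.card_nsmul_le_sum _ _ _ hval
    _ ≤ ∑ t ∈ Finset.Icc (-(R : ℤ)) R, h t ^ 2 :=
        Finset.sum_le_sum_of_subset_of_nonneg hsub fun t _ _ => sq_nonneg _

/-- The increment `h_R(t) − h_R(t − s)` vanishes off the window `[−R − |s|, R + |s|]`. [folklore] -/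
theorem tent_incr_support (hh : ∀ t, h t = max 0 ((R : ℝ) - |(t : ℝ)|)) (s t : ℤ)
    (ht : t ∉ Finset.Icc (-(R : ℤ) - |s|) (R + |s|)) : (h t - h (t - s)) ^ 2 = 0 := by
  rw [Finset.mem_Icc, not_and_or, not_le, not_le] at ht
  have h1 : h t = 0 := tent_eq_zero hh (by rcases ht with ht | ht <;> cases abs_cases t <;> cases abs_cases s <;> omega)
  have h2 : h (t - s) = 0 :=
    tent_eq_zero hh (by rcases ht with ht | ht <;> cases abs_cases (t - s) <;> cases abs_cases s <;> omega)
  rw [h1, h2]; ring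

/-- `d_R(s)` is the finite sum over the window `[−R − |s|, R + |s|]`. [folklore] -/
theorem tsum_tent_incr_eq_sum (hh : ∀ t, h t = max 0 ((R : ℝ) - |(t : ℝ)|)) (s : ℤ) :
    ∑' t, (h t - h (t - s)) ^ 2 = ∑ t ∈ Finset.Icc (-(R : ℤ) - |s|) (R + |s|), (h t - h (t - s)) ^ 2 :=
  tsum_eq_sum fun t ht => tent_incr_support hh s t ht

/-- **Upper member of the sandwich**: `d_R(s) = Σ_t (h_R(t) − h_R(t−s))² ≤ (2R + 2|s| + 1)·s²` (1-Lipschitz on a window of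
`2R + 2|s| + 1` sites). [folklore] -/
theorem tent_incr_le (hh : ∀ t, h t = max 0 ((R : ℝ) - |(t : ℝ)|)) (s : ℤ) :
    ∑' t, (h t - h (t - s)) ^ 2 ≤ (2 * R + 2 * |(s : ℝ)| + 1) * (s : ℝ) ^ 2 := by
  rw [tsum_tent_incr_eq_sum hh s]
  have hcard : ((Finset.Icc (-(R : ℤ) - |s|) (R + |s|)).card : ℝ) = 2 * R + 2 * |(s : ℝ)| + 1 := by
    have h1 : ((Finset.Icc (-(R : ℤ) - |s|) (R + |s|)).card : ℤ) = 2 * R + 2 * |s| + 1 := by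
      rw [Int.card_Icc, Int.toNat_of_nonneg (by cases abs_cases s <;> omega)]; ring
    have h2 : (((Finset.Icc (-(R : ℤ) - |s|) (R + |s|)).card : ℤ) : ℝ) = ((2 * R + 2 * |s| + 1 : ℤ) : ℝ) := by
      rw [h1]
    push_cast at h2
    exact h2
  have hle : ∀ t ∈ Finset.Icc (-(R : ℤ) - |s|) (R + |s|), (h t - h (t - s)) ^ 2 ≤ (s : ℝ) ^ 2 := by
    intro t _
    have hl := tent_lipschitz hh t (t - s)
    have e : ((t : ℝ) - ((t - s : ℤ) : ℝ)) = s := by push_cast; ring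
    rw [e] at hl
    calc (h t - h (t - s)) ^ 2 = |h t - h (t - s)| ^ 2 := (sq_abs _).symm
      _ ≤ |(s : ℝ)| ^ 2 := pow_le_pow_left₀ (abs_nonneg _) hl 2
      _ = (s : ℝ) ^ 2 := sq_abs _
  calc ∑ t ∈ Finset.Icc (-(R : ℤ) - |s|) (R + |s|), (h t - h (t - s)) ^ 2
      ≤ (Finset.Icc (-(R : ℤ) - |s|) (R + |s|)).card • (s : ℝ) ^ 2 := Finset.sum_le_card_nsmul _ _ _ hle
    _ = (2 * R + 2 * |(s : ℝ)| + 1) * (s : ℝ) ^ 2 := by rw [nsmul_eq_mul, hcard]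

/-- **Lower member of the sandwich**: for `1 ≤ s ≤ R`, `2(R − s + 1)·s² ≤ d_R(s)` (on `s ≤ t ≤ R` the increment is `−s`, on
`−R + s ≤ t ≤ 0` it is `+s`). [folklore] -/
theorem tent_incr_ge (hh : ∀ t, h t = max 0 ((R : ℝ) - |(t : ℝ)|)) {s : ℤ} (hs1 : 1 ≤ s) (hsR : s ≤ R) :
    2 * ((R : ℝ) - s + 1) * (s : ℝ) ^ 2 ≤ ∑' t, (h t - h (t - s)) ^ 2 := by
  rw [tsum_tent_incr_eq_sum hh s]
  have habs : |s| = s := abs_of_pos (by omega)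
  set W := Finset.Icc (-(R : ℤ) - |s|) (R + |s|)
  set A := Finset.Icc s (R : ℤ)
  set A' := Finset.Icc (-(R : ℤ) + s) 0
  have hdisj : Disjoint A A' := by
    rw [Finset.disjoint_left]; intro t ht ht'
    rw [Finset.mem_Icc] at ht ht'; omega
  have hsub : A ∪ A' ⊆ W := by
    intro t ht
    rw [Finset.mem_union, Finset.mem_Icc, Finset.mem_Icc] at ht
    rw [Finset.mem_Icc, habs]; omega
  have hA : ∀ t ∈ A, (h t - h (t - s)) ^ 2 = (s : ℝ) ^ 2 := by
    intro t ht; rw [Finset.mem_Icc] at ht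
    rw [tent_eq_of_nonneg hh (by omega) ht.2, tent_eq_of_nonneg hh (t := t - s) (by omega) (by omega)]
    push_cast; ring
  have hA' : ∀ t ∈ A', (h t - h (t - s)) ^ 2 = (s : ℝ) ^ 2 := by
    intro t ht; rw [Finset.mem_Icc] at ht
    rw [tent_eq_of_nonpos hh ht.2 (by omega), tent_eq_of_nonpos hh (t := t - s) (by omega) (by omega)]
    push_cast; ring
  have hcardA : (A.card : ℝ) = (R : ℝ) - s + 1 := by
    have : A.card = ((R : ℤ) + 1 - s).toNat := Int.card_Icc _ _
    rw [this]
    have h2 : (((R : ℤ) + 1 - s).toNat : ℤ) = (R : ℤ) + 1 - s := Int.toNat_of_nonneg (by omega)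
    have h3 : ((((R : ℤ) + 1 - s).toNat : ℕ) : ℝ) = (((R : ℤ) + 1 - s : ℤ) : ℝ) := by exact_mod_cast h2
    rw [h3]; push_cast; ring
  have hcardA' : (A'.card : ℝ) = (R : ℝ) - s + 1 := by
    have : A'.card = ((0 : ℤ) + 1 - (-(R : ℤ) + s)).toNat := Int.card_Icc _ _
    rw [this]
    have h2 : (((0 : ℤ) + 1 - (-(R : ℤ) + s)).toNat : ℤ) = (0 : ℤ) + 1 - (-(R : ℤ) + s) :=
      Int.toNat_of_nonneg (by omega)
    have h3 : ((((0 : ℤ) + 1 - (-(R : ℤ) + s)).toNat : ℕ) : ℝ) = (((0 : ℤ) + 1 - (-(R : ℤ) + s) : ℤ) : ℝ) := by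
      exact_mod_cast h2
    rw [h3]; push_cast; ring
  calc 2 * ((R : ℝ) - s + 1) * (s : ℝ) ^ 2
      = ∑ t ∈ A, (s : ℝ) ^ 2 + ∑ t ∈ A', (s : ℝ) ^ 2 := by
        rw [Finset.sum_const, Finset.sum_const, nsmul_eq_mul, nsmul_eq_mul, hcardA, hcardA']; ring
    _ = ∑ t ∈ A, (h t - h (t - s)) ^ 2 + ∑ t ∈ A', (h t - h (t - s)) ^ 2 := by
        rw [Finset.sum_congr rfl hA, Finset.sum_congr rfl hA']
    _ = ∑ t ∈ A ∪ A', (h t - h (t - s)) ^ 2 := (Finset.sum_union hdisj).symm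
    _ ≤ ∑ t ∈ W, (h t - h (t - s)) ^ 2 := Finset.sum_le_sum_of_subset_of_nonneg hsub fun t _ _ => sq_nonneg _


/-- `2R ≤ d_R(1)` (`R ≥ 1`). [folklore] -/
theorem tent_incr_one_ge (hh : ∀ t, h t = max 0 ((R : ℝ) - |(t : ℝ)|)) (hR : 1 ≤ R) :
    2 * (R : ℝ) ≤ ∑' t, (h t - h (t - 1)) ^ 2 := by
  have h1 := tent_incr_ge hh (s := 1) le_rfl (by exact_mod_cast hR)
  push_cast at h1; linarith

/-- `d_R(1) ≤ 2R + 3`. [folklore] -/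
theorem tent_incr_one_le (hh : ∀ t, h t = max 0 ((R : ℝ) - |(t : ℝ)|)) :
    ∑' t, (h t - h (t - 1)) ^ 2 ≤ 2 * (R : ℝ) + 3 := by
  have h1 := tent_incr_le hh 1
  push_cast at h1; simp only [abs_one] at h1; linarith

/-- The increment form only depends on `|s|`: `d_R(s) = d_R(|s|)`. [folklore] -/
theorem tent_incr_abs (s : ℤ) : ∑' t, (h t - h (t - s)) ^ 2 = ∑' t, (h t - h (t - |s|)) ^ 2 := by
  rcases abs_choice s with hs | hs
  · rw [hs]
  · rw [hs, tsum_sq_sub_shift_symm h s]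
    exact tsum_congr fun t => by rw [sub_neg_eq_add]

/-- **The sandwich in ratio form**: for `R ≥ max(1, |s|)`,
`|d_R(s)/d_R(1) − s²| ≤ (2|s| + 1)s² / (2R)`. [folklore] -/
theorem tent_incr_ratio_sub_sq_le (hh : ∀ t, h t = max 0 ((R : ℝ) - |(t : ℝ)|)) (hR : 1 ≤ R) {s : ℤ}
    (hsR : |s| ≤ R) :
    |(∑' t, (h t - h (t - s)) ^ 2) / (∑' t, (h t - h (t - 1)) ^ 2) - (s : ℝ) ^ 2|
      ≤ (2 * |(s : ℝ)| + 1) * (s : ℝ) ^ 2 / (2 * R) := by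
  have hR0 : (0 : ℝ) < R := by exact_mod_cast hR
  have hd1 : 2 * (R : ℝ) ≤ ∑' t, (h t - h (t - 1)) ^ 2 := tent_incr_one_ge hh hR
  have hd1' : ∑' t, (h t - h (t - 1)) ^ 2 ≤ 2 * (R : ℝ) + 3 := tent_incr_one_le hh
  have hd1pos : (0 : ℝ) < ∑' t, (h t - h (t - 1)) ^ 2 := by linarith
  set d1 := ∑' t, (h t - h (t - 1)) ^ 2 with hd1def
  rw [tent_incr_abs s]
  set σ : ℤ := |s| with hσ
  have hσ0 : 0 ≤ σ := abs_nonneg s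
  have hσs : ((σ : ℝ)) = |(s : ℝ)| := by rw [hσ, Int.cast_abs]
  have hsq : (s : ℝ) ^ 2 = (σ : ℝ) ^ 2 := by rw [hσs, sq_abs]
  rw [hsq, ← hσs]
  have hup : ∑' t, (h t - h (t - σ)) ^ 2 ≤ (2 * R + 2 * (σ : ℝ) + 1) * (σ : ℝ) ^ 2 := by
    have := tent_incr_le hh σ
    rwa [abs_of_nonneg (by exact_mod_cast hσ0 : (0 : ℝ) ≤ σ)] at this
  rcases hσ0.eq_or_lt with hz | hpos
  · -- s = 0
    rw [← hz]; simp
  · have hlow : 2 * ((R : ℝ) - σ + 1) * (σ : ℝ) ^ 2 ≤ ∑' t, (h t - h (t - σ)) ^ 2 :=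
      tent_incr_ge hh (by omega) hsR
    set dσ := ∑' t, (h t - h (t - σ)) ^ 2 with hdσ
    have hσr : (0 : ℝ) ≤ σ := by exact_mod_cast hσ0
    rw [abs_le]
    constructor
    · -- lower: σ² − dσ/d1 ≤ (2σ+1)σ²/(2R)
      have h1 : (σ : ℝ) ^ 2 - dσ / d1 ≤ (σ : ℝ) ^ 2 - 2 * ((R : ℝ) - σ + 1) * (σ : ℝ) ^ 2 / (2 * R + 3) := by
        have : 2 * ((R : ℝ) - σ + 1) * (σ : ℝ) ^ 2 / (2 * R + 3) ≤ dσ / d1 := by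
          rw [div_le_div_iff₀ (by linarith) hd1pos]
          calc 2 * ((R : ℝ) - σ + 1) * (σ : ℝ) ^ 2 * d1 ≤ 2 * ((R : ℝ) - σ + 1) * (σ : ℝ) ^ 2 * (2 * R + 3) := by
                have : (0 : ℝ) ≤ 2 * ((R : ℝ) - σ + 1) * (σ : ℝ) ^ 2 := by
                  have : (σ : ℝ) ≤ R := by exact_mod_cast hsR
                  positivity
                exact mul_le_mul_of_nonneg_left hd1' this
            _ ≤ dσ * (2 * R + 3) := mul_le_mul_of_nonneg_right hlow (by linarith)
        linarith
      have h2 : (σ : ℝ) ^ 2 - 2 * ((R : ℝ) - σ + 1) * (σ : ℝ) ^ 2 / (2 * R + 3)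
          = (2 * (σ : ℝ) + 1) * (σ : ℝ) ^ 2 / (2 * R + 3) := by
        field_simp; ring
      have h3 : (2 * (σ : ℝ) + 1) * (σ : ℝ) ^ 2 / (2 * R + 3) ≤ (2 * (σ : ℝ) + 1) * (σ : ℝ) ^ 2 / (2 * R) :=
        div_le_div_of_nonneg_left (by positivity) (by linarith) (by linarith)
      linarith
    · -- upper: dσ/d1 − σ² ≤ (2σ+1)σ²/(2R)
      have h1 : dσ / d1 ≤ (2 * R + 2 * (σ : ℝ) + 1) * (σ : ℝ) ^ 2 / (2 * R) := by
        rw [div_le_div_iff₀ hd1pos (by linarith)]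
        calc dσ * (2 * R) ≤ (2 * R + 2 * (σ : ℝ) + 1) * (σ : ℝ) ^ 2 * (2 * R) :=
              mul_le_mul_of_nonneg_right hup (by linarith)
          _ ≤ (2 * R + 2 * (σ : ℝ) + 1) * (σ : ℝ) ^ 2 * d1 := mul_le_mul_of_nonneg_left hd1 (by positivity)
      have h2 : (2 * R + 2 * (σ : ℝ) + 1) * (σ : ℝ) ^ 2 / (2 * R) - (σ : ℝ) ^ 2
          = (2 * (σ : ℝ) + 1) * (σ : ℝ) ^ 2 / (2 * R) := by
        field_simp; ring
      linarith

/-- **`d_R(s)/d_R(1) → s²`** as `R → ∞`, for every fixed `s ∈ ℤ` (the tents as a family `h R`). [folklore] -/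
theorem tendsto_tent_incr_ratio (g : ℕ → ℤ → ℝ) (hg : ∀ R t, g R t = max 0 ((R : ℝ) - |(t : ℝ)|)) (s : ℤ) :
    Tendsto (fun R : ℕ => (∑' t, (g R t - g R (t - s)) ^ 2) / (∑' t, (g R t - g R (t - 1)) ^ 2))
      atTop (𝓝 ((s : ℝ) ^ 2)) := by
  rw [tendsto_iff_norm_sub_tendsto_zero]
  refine squeeze_zero_norm' ?_ (tendsto_const_div_atTop_nhds_zero_nat ((2 * |(s : ℝ)| + 1) * (s : ℝ) ^ 2 / 2))
  rw [eventually_atTop]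
  refine ⟨max 1 s.natAbs, fun R hR => ?_⟩
  simp only [Real.norm_eq_abs, abs_abs]
  have hR1 : 1 ≤ R := le_of_max_le_left hR
  have hRs : |s| ≤ (R : ℤ) := by
    have : s.natAbs ≤ R := le_of_max_le_right hR
    rw [← Int.natCast_natAbs]; exact_mod_cast this
  have key := tent_incr_ratio_sub_sq_le (hg R) hR1 hRs
  have e : (2 * |(s : ℝ)| + 1) * (s : ℝ) ^ 2 / (2 * R) = (2 * |(s : ℝ)| + 1) * (s : ℝ) ^ 2 / 2 / R := by
    rw [div_div]
  rwa [e] at key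

end Tent

end Summit.QuantumFields.BalabanUV.Beta.EriceTentCalculus
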